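/-
Copyright: cell pub-balaban-gaps (YM BLITZ Y1, track G1), seat g1-p2 GEN 12 (unit `pub-balaban-gaps-g1-p2`).  Row (D4) NODE O,
MECHANISM level — ROAD (c′) of g1-plan-1 GEN 39 ([G1-PLAN1-G39-PRECISION-110] (ψ3)–(ψ4)): the KERNEL SHAPES of the seed
`Σ_□ fibD(h_□ĝ_□⁻¹)·A′_□⁻¹·fibD(h_□ĝ_□)` and of the step `Σ_□ fibD ĝ_□⁻¹·([h_□⊗1, A′_□]A′_□⁻¹)·fibD(h_□ĝ_□)` of (3.87)–(3.88), and 124's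
resummation `Δ′·S = 1 − R` rewritten in these shapes; rows ∕ columns of `fibD w·M`, `M·fibD w` vanish where `w` does.  HONEST FRAMING:
[folklore] algebra over 124; local data, gauges, partition are data; nothing of Bałaban's `Δ^{(k)}(𝐔)` is constructed; words of row
(D4) UNCHANGED (`ExistsUniformAcrossSmall` + `TermDomination`, OBJECT level); (D4) instance 0∕1; NOT BetaPertH, NOT continuum, NOT Clay.
-/
import Summits.QuantumFields.BalabanUV.Gaps.D4WalkBlockSeedResummation

/-!
# `Gaps.D4WalkBlockSeedShapes` — kernel shapes of the seed and the step of (3.87)–(3.88) (cell pub-balaban-gaps, seat g1-p2 gen 12)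

HONEST DEPENDENCY (cell pub-balaban, verbatim): continuum YM on T⁴ ⇐ BetaPertH ∧ nine spine estimates (0/9 proved);
BetaPertH ⇐ (D1) ∧ (D4) ∧ CAP+tail.

* `fibD_mul_apply_of_zero` ∕ `mul_fibD_apply_of_zero`, `rowSum_fibD_smul_le` (`|h| ≤ 1`, rows of `g ≤ r` ⟹ rows of `fibD(h·g) ≤ r`);
* `seed_shape` (`(h⊗1)(fibD g⁻¹·M·fibD g)(h⊗1) = fibD(hg⁻¹)·M·fibD(hg)`), `step_shape` (`((h⊗1)A_□ − A_□(h⊗1))G_□(h⊗1) =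
  fibD g⁻¹·([h⊗1, A′]A′⁻¹)·fibD(hg)`), **`covOp_resummation_shapes`** (124's `covOp_resummation` in these shapes:
  `Δ′(u)·Σ_b fibD(h_bg_b⁻¹)A′_b⁻¹fibD(h_bg_b) = 1 − Σ_b fibD g_b⁻¹([h_b⊗1, A′_b]A′_b⁻¹)fibD(h_bg_b)`).
WHAT IT IS NOT.  The block walk expansions (127 + 128 + 55) and the END of road (c′): next file; OBJECT level untouched.

References (method only): T. Bałaban, Comm. Math. Phys. **99** (1985) 389–434 [B9], (3.87)–(3.88) p. 409, p. 410.
-/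

noncomputable section

namespace Summit.QuantumFields.BalabanUV.Gaps.D4WalkBlockSeedShapes

open Finset Complex Matrix
open scoped BigOperators Matrix
open Literature.MathematicalPhysics.QuantumFieldTheory.Balaban1983to89
open Literature.MathematicalPhysics.QuantumFieldTheory.Balaban1983to89.B5Ineq137Torus (blk)
open Summit.QuantumFields.BalabanUV.Gaps.D4WalkBlockShiftAlgebra (fibD)
open Summit.QuantumFields.BalabanUV.Gaps.D4WalkBlockShiftWeighted (wOp wOp_mul_fibD fibD_mul_wOp)
open Summit.QuantumFields.BalabanUV.Gaps.D4WalkBlockGaugeAlgebra (rowSum_fibD fibD_mul_fibD_eq_one)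
open Summit.QuantumFields.BalabanUV.Gaps.D4WalkBlockCovariantPropagator (covOp)
open Summit.QuantumFields.BalabanUV.Gaps.D4WalkBlockCovariantBlockAveraging (PU)
open Summit.QuantumFields.BalabanUV.Gaps.D4WalkBlockSeedResummation (wOp_mul_conj conj_mul_wOp covOp_resummation)

variable (P : Params) (F : Type) [Fintype F] [DecidableEq F]
variable {E : Type*}

/-! ## §1. Shapes -/

section Shapes
variable {X : Type} [Fintype X] [DecidableEq X]

omit [DecidableEq F] in
/-- rows of `fibD w·M` vanish at the sites where `w` does. ([folklore]) -/
theorem fibD_mul_apply_of_zero (w : X → Matrix F F ℂ) (M : Matrix (X × F) (X × F) ℂ) (p : X × F)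
    (hw : w p.1 = 0) (j : X × F) : (fibD X F w * M) p j = 0 := by
  rw [Matrix.mul_apply]
  refine Finset.sum_eq_zero fun k _ => ?_
  unfold fibD
  rw [Matrix.of_apply]
  split_ifs with h1
  · rw [hw, Matrix.zero_apply, zero_mul]
  · rw [zero_mul]

omit [DecidableEq F] in
/-- columns of `M·fibD w` vanish at the sites where `w` does. ([folklore]) -/
theorem mul_fibD_apply_of_zero (M : Matrix (X × F) (X × F) ℂ) (w : X → Matrix F F ℂ) (q : X × F)
    (hw : w q.1 = 0) (i : X × F) : (M * fibD X F w) i q = 0 := by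
  rw [Matrix.mul_apply]
  refine Finset.sum_eq_zero fun k _ => ?_
  unfold fibD
  rw [Matrix.of_apply]
  split_ifs with h1
  · rw [h1, hw, Matrix.zero_apply, mul_zero]
  · rw [mul_zero]

omit [DecidableEq F] in
/-- `|h| ≤ 1` and rows of `g(x)` at most `r` ⟹ rows of `fibD(h·g)` at most `r`. ([folklore]) -/
theorem rowSum_fibD_smul_le (hh : X → ℝ) (g : X → Matrix F F ℂ) {r : ℝ} (h1 : ∀ x, |hh x| ≤ 1)
    (hg : ∀ x a', ∑ b, ‖g x a' b‖ ≤ r) (p : X × F) :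
    ∑ q, ‖fibD X F (fun x => (((hh x : ℝ) : ℂ)) • g x) p q‖ ≤ r := by
  rw [rowSum_fibD]
  have hr : 0 ≤ r := le_trans (Finset.sum_nonneg fun b _ => norm_nonneg _) (hg p.1 p.2)
  calc ∑ b, ‖((((hh p.1 : ℝ) : ℂ)) • g p.1) p.2 b‖ = |hh p.1| * ∑ b, ‖g p.1 p.2 b‖ := by
        rw [Finset.mul_sum]
        exact Finset.sum_congr rfl fun b _ => by
          rw [Matrix.smul_apply, smul_eq_mul, norm_mul, Complex.norm_real, Real.norm_eq_abs]
    _ ≤ 1 * r := mul_le_mul (h1 p.1) (hg p.1 p.2) (Finset.sum_nonneg fun b _ => norm_nonneg _) zero_le_one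
    _ = r := one_mul r

/-- **SEED SHAPE**: `(h⊗1)·(fibD g⁻¹·M·fibD g)·(h⊗1) = fibD(h·g⁻¹)·M·fibD(h·g)`. ([folklore]) -/
theorem seed_shape (hh : X → ℝ) (g gi : X → Matrix F F ℂ) (M : Matrix (X × F) (X × F) ℂ) :
    wOp X F hh * (fibD X F gi * M * fibD X F g) * wOp X F hh
      = fibD X F (fun x => (((hh x : ℝ) : ℂ)) • gi x) * M * fibD X F (fun x => (((hh x : ℝ) : ℂ)) • g x) := by
  rw [← wOp_mul_fibD hh gi, ← fibD_mul_wOp hh g]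
  simp only [Matrix.mul_assoc]

/-- **STEP SHAPE**: `((h⊗1)A_□ − A_□(h⊗1))·G_□·(h⊗1) = fibD g⁻¹·([h⊗1, A′]·A′⁻¹)·fibD(h·g)` for `A_□ = fibD g⁻¹A′fibD g`, `G_□ = fibD g⁻¹A′⁻¹fibD g`,
`gg⁻¹ = 1`. ([folklore]) -/
theorem step_shape (hh : X → ℝ) (g gi : X → Matrix F F ℂ) (hg : ∀ x, g x * gi x = 1) (A' Ai : Matrix (X × F) (X × F) ℂ) :
    (wOp X F hh * (fibD X F gi * A' * fibD X F g) - (fibD X F gi * A' * fibD X F g) * wOp X F hh) *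
        (fibD X F gi * Ai * fibD X F g) * wOp X F hh
      = fibD X F gi * ((wOp X F hh * A' - A' * wOp X F hh) * Ai) * fibD X F (fun x => (((hh x : ℝ) : ℂ)) • g x) := by
  have hgg : ∀ Z : Matrix (X × F) (X × F) ℂ, fibD X F g * (fibD X F gi * Z) = Z := fun Z => by
    rw [← Matrix.mul_assoc, fibD_mul_fibD_eq_one hg, Matrix.one_mul]
  rw [wOp_mul_conj, conj_mul_wOp, ← fibD_mul_wOp hh g]
  have e : fibD X F gi * (wOp X F hh * A') * fibD X F g - fibD X F gi * (A' * wOp X F hh) * fibD X F g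
      = fibD X F gi * (wOp X F hh * A' - A' * wOp X F hh) * fibD X F g := by
    rw [Matrix.mul_sub, Matrix.sub_mul]
  rw [e]
  simp only [Matrix.mul_assoc, hgg, Matrix.sub_mul]

end Shapes

/-! ## §2. The resummation in kernel shapes -/

section Resummation
variable {B : Type} [Fintype B]
variable (Wp Wm : Fin P.d → E → Site P 0 → Matrix F F ℂ) (Ug Ugi : E → Site P 0 → Matrix F F ℂ) (a msq : ℝ)
variable (g gi : B → Site P 0 → Matrix F F ℂ) (Wpl Wml : B → Fin P.d → E → Site P 0 → Matrix F F ℂ)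
  (Ugl Ugil : B → E → Site P 0 → Matrix F F ℂ) (S : B → Set (Site P 0)) (h : B → Site P 0 → ℝ)

/-- **124's `covOp_resummation` IN THE KERNEL SHAPES OF THE ASSEMBLY**: with `A′_b = covOp(local data)`,
`Δ′(u)·Σ_b fibD(h_bg_b⁻¹)A′_b⁻¹fibD(h_bg_b) = 1 − Σ_b fibD g_b⁻¹·([h_b⊗1, A′_b]A′_b⁻¹)·fibD(h_bg_b)`.
[cite: Balaban1985BackgroundPropagators, (3.87)–(3.88) p.409, p.410] -/
theorem covOp_resummation_shapes (hg : ∀ b x, g b x * gi b x = 1) (hgi : ∀ b x, gi b x * g b x = 1)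
    (hh : ∀ b y, y ∉ S b → h b y = 0) (hsum : ∀ x, ∑ b, h b x ^ 2 = 1) (u : E)
    (hp : ∀ b μ y, y ∈ S b → Wpl b μ u (Site.unshift y μ) =
      g b (Site.unshift y μ) * (1 + Wp μ u (Site.unshift y μ)) * gi b (Site.shift (Site.unshift y μ) μ) - 1)
    (hm : ∀ b μ y, y ∈ S b → Wml b μ u (Site.shift y μ) =
      g b (Site.shift y μ) * (1 + Wm μ u (Site.shift y μ)) * gi b (Site.unshift (Site.shift y μ) μ) - 1)
    (hUgi : ∀ b x y, y ∈ S b → blk P P.K x = blk P P.K y → Ugil b u x = g b x * Ugi u x)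
    (hUg : ∀ b y, y ∈ S b → Ugl b u y = Ug u y * gi b y)
    (hA' : ∀ b, IsUnit (covOp P F (Wpl b) (Wml b) (PU P F (Ugl b) (Ugil b)) a msq u).det) :
    covOp P F Wp Wm (PU P F Ug Ugi) a msq u *
        ∑ b, fibD (Site P 0) F (fun x => (((h b x : ℝ) : ℂ)) • gi b x) *
          (covOp P F (Wpl b) (Wml b) (PU P F (Ugl b) (Ugil b)) a msq u)⁻¹ * fibD (Site P 0) F (fun x => (((h b x : ℝ) : ℂ)) • g b x)
      = 1 - ∑ b, fibD (Site P 0) F (gi b) *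
          ((wOp (Site P 0) F (h b) * covOp P F (Wpl b) (Wml b) (PU P F (Ugl b) (Ugil b)) a msq u -
              covOp P F (Wpl b) (Wml b) (PU P F (Ugl b) (Ugil b)) a msq u * wOp (Site P 0) F (h b)) *
            (covOp P F (Wpl b) (Wml b) (PU P F (Ugl b) (Ugil b)) a msq u)⁻¹) *
          fibD (Site P 0) F (fun x => (((h b x : ℝ) : ℂ)) • g b x) := by
  have hres := covOp_resummation P F Wp Wm Ug Ugi a msq g gi Wpl Wml Ugl Ugil S h hg hgi hh hsum u hp hm hUgi hUg hA'
  have e1 : (∑ b, wOp (Site P 0) F (h b) *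
        (fibD (Site P 0) F (gi b) * (covOp P F (Wpl b) (Wml b) (PU P F (Ugl b) (Ugil b)) a msq u)⁻¹ * fibD (Site P 0) F (g b)) *
        wOp (Site P 0) F (h b))
      = ∑ b, fibD (Site P 0) F (fun x => (((h b x : ℝ) : ℂ)) • gi b x) *
          (covOp P F (Wpl b) (Wml b) (PU P F (Ugl b) (Ugil b)) a msq u)⁻¹ * fibD (Site P 0) F (fun x => (((h b x : ℝ) : ℂ)) • g b x) :=
    Finset.sum_congr rfl fun b _ => seed_shape F (h b) (g b) (gi b) _
  have e2 : (∑ b, (wOp (Site P 0) F (h b) *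
          (fibD (Site P 0) F (gi b) * covOp P F (Wpl b) (Wml b) (PU P F (Ugl b) (Ugil b)) a msq u * fibD (Site P 0) F (g b)) -
        (fibD (Site P 0) F (gi b) * covOp P F (Wpl b) (Wml b) (PU P F (Ugl b) (Ugil b)) a msq u * fibD (Site P 0) F (g b)) *
          wOp (Site P 0) F (h b)) *
        (fibD (Site P 0) F (gi b) * (covOp P F (Wpl b) (Wml b) (PU P F (Ugl b) (Ugil b)) a msq u)⁻¹ * fibD (Site P 0) F (g b)) *
        wOp (Site P 0) F (h b))
      = ∑ b, fibD (Site P 0) F (gi b) *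
          ((wOp (Site P 0) F (h b) * covOp P F (Wpl b) (Wml b) (PU P F (Ugl b) (Ugil b)) a msq u -
              covOp P F (Wpl b) (Wml b) (PU P F (Ugl b) (Ugil b)) a msq u * wOp (Site P 0) F (h b)) *
            (covOp P F (Wpl b) (Wml b) (PU P F (Ugl b) (Ugil b)) a msq u)⁻¹) *
          fibD (Site P 0) F (fun x => (((h b x : ℝ) : ℂ)) • g b x) :=
    Finset.sum_congr rfl fun b _ => step_shape F (h b) (g b) (gi b) (hg b) _ _
  rw [e1, e2] at hres
  exact hres

end Resummation

end Summit.QuantumFields.BalabanUV.Gaps.D4WalkBlockSeedShapes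

end
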